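import Mathlib
import Literature.Analysis.FluidPDE.Tao2016AveragedNS.RenormalisedCascadeWaves
import Literature.Analysis.FluidPDE.Tao2016AveragedNS.BoundedEternalSolutions

/-!
# Crux `TaoLadderRungTwoBreak.NoSurvivingEternalViscBddOne` (stmt-NavierStokesRegularity-20419), stub (ρ0), DYADIC MEMBER:
# two a-priori estimates for non-negative ancient solutions of the Katz–Pavlović chain in critical variables —
# NO OVERSHOOT (`V_n(t) ≤ e^{M/Λ} v_n`) and BOUNDED TERMINAL GROWTH (`v_{n+1} ≤ Λ M e^{M/Λ} v_n`)

MODEL lattice ODEs only (Tao 2016 §1.2/§4, critical variables of §6.4); nothing here is a statement about the Navier–Stokes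
equations; no stub, crux, rung or summit is proved (`--supports stmt-NavierStokesRegularity-20419`).  Route-independent, DEF-FREE,
classical real analysis on the objects of the tree's `dyadic_noSurviving_iff_classicalPos` (the classical form of (ρ0)|dyadic):
real shells `V_n`, `n ∈ ℤ`, on `t < 0` with

  `V̇_n = Λ V_{n-1}² − Λ⁻¹ V_n V_{n+1}`,  `V_n ≥ 0`,  `∫_{(-∞,0)} |V_n| ≤ M` (all `n`),  `V_n(t) → v_n` as `t ↑ 0`.

* `le_exp_mul_of_le` / `noOvershoot` — **NO OVERSHOOT**: `V_n(t) ≤ e^{M/Λ} V_n(s)` for `t ≤ s < 0`, hence `V_n(t) ≤ e^{M/Λ} v_n` for every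
  `t < 0`: the drain `−Λ⁻¹V_nV_{n+1}` can remove at most the factor `e^{-M/Λ}` over the whole history (the feed is non-negative), so the
  TERMINAL value controls the entire past of the shell; in particular a shell that is ever positive strands a positive wake
  (`terminal_pos_of_pos`).
* `terminal_succ_le` — **BOUNDED TERMINAL GROWTH** under the type-I decay `V_{n+1}(t) → 0` as `t → -∞`: `v_{n+1} ≤ Λ M e^{M/Λ} v_n`
  (integrate `V̇_{n+1} ≤ ΛV_n² ≤ Λ e^{M/Λ} v_n V_n`).
* `terminal_le_geometric` — hence `v_n ≤ (Λ M e^{M/Λ})ⁿ v_0` for `n ≥ 0`: the terminal profile of an ancient solution grows at most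
  geometrically, with ratio set by the ACTION `M` alone; with `…WakeDyadicRegularity.tendsto_weightedWake_of_terminalRegularity` this is the
  small-action slice of (ρ0)|dyadic in classical form (ratio `< (1+ε₀)² = Λ^{4/5}`), and in general the first a-priori bound of the
  W1-dyadic line (uniform-in-base supercritical terminal regularity, census of this hand).

HONEST LABEL: elementary a-priori estimates (Gronwall by monotonicity); (ρ0), ⟨20419⟩ and every NS statement remain OPEN; rung 0.
-/

noncomputable section

-- the summit and its single sub-problem share the name (CONVENTIONS §1)
set_option linter.dupNamespace false

namespace Summit.NavierStokesRegularity.NavierStokesRegularity.Theorems.NoSurvivingEternalViscBddOne.DyadicAncient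

open Filter Topology Set MeasureTheory intervalIntegral
open Literature.Analysis.FluidPDE Literature.Analysis.FluidPDE.TaoCascade

variable {ε₀ : ℝ} {V : ℤ → ℝ → ℝ}

/-- Shells of a classical solution are continuous on `(-∞,0)`. [elementary] -/
theorem continuousOn_shell
    (hV : ∀ (n : ℤ) (t : ℝ), t < 0 →
      HasDerivAt (V n) (bigLam ε₀ * V (n - 1) t ^ 2 - (bigLam ε₀)⁻¹ * (V n t * V (n + 1) t)) t)
    (n : ℤ) : ContinuousOn (V n) (Iio 0) :=
  fun t ht => ((hV n t ht).continuousAt).continuousWithinAt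

/-- Shells are interval-integrable on compact subintervals of `(-∞,0)`. [elementary] -/
theorem intervalIntegrable_shell
    (hV : ∀ (n : ℤ) (t : ℝ), t < 0 →
      HasDerivAt (V n) (bigLam ε₀ * V (n - 1) t ^ 2 - (bigLam ε₀)⁻¹ * (V n t * V (n + 1) t)) t)
    (n : ℤ) {a b : ℝ} (ha : a < 0) (hb : b < 0) : IntervalIntegrable (V n) volume a b := by
  refine ContinuousOn.intervalIntegrable ((continuousOn_shell hV n).mono ?_)
  intro x hx
  rw [mem_uIcc] at hx
  rcases hx with ⟨_, h2⟩ | ⟨_, h2⟩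
  · exact lt_of_le_of_lt h2 hb
  · exact lt_of_le_of_lt h2 ha

/-- The partial action is bounded by the total action: `∫_a^b V_k ≤ M` for `a ≤ b < 0` (`V_k ≥ 0`). [elementary] -/
theorem integral_shell_le
    (hpos : ∀ (n : ℤ) (t : ℝ), t < 0 → 0 ≤ V n t)
    {M : ℝ} (hact : ∀ n : ℤ, IntegrableOn (fun t => |V n t|) (Iio 0) ∧ ∫ t in Iio 0, |V n t| ≤ M)
    (k : ℤ) {a b : ℝ} (hab : a ≤ b) (hb : b < 0) : ∫ t in a..b, V k t ≤ M := by
  obtain ⟨hint, hM⟩ := hact k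
  rw [intervalIntegral.integral_of_le hab]
  have hsub : Ioc a b ⊆ Iio 0 := fun x hx => lt_of_le_of_lt hx.2 hb
  have h1 : ∫ t in Ioc a b, V k t = ∫ t in Ioc a b, |V k t| := by
    refine setIntegral_congr_fun measurableSet_Ioc fun x hx => ?_
    rw [abs_of_nonneg (hpos k x (hsub hx))]
  rw [h1]
  calc ∫ t in Ioc a b, |V k t| ≤ ∫ t in Iio 0, |V k t| :=
        setIntegral_mono_set hint (Eventually.of_forall fun x => abs_nonneg _) (Eventually.of_forall hsub)
    _ ≤ M := hM

/-- **No overshoot, two-time form.**  For `t ≤ s < 0`: `V_n(t) ≤ exp(Λ⁻¹ ∫_t^s V_{n+1}) · V_n(s) ≤ e^{M/Λ} V_n(s)` — the function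
`u ↦ V_n(u) exp(Λ⁻¹∫_t^u V_{n+1})` has derivative `exp(…) Λ V_{n-1}² ≥ 0`.
[cite: Tao2016AveragedNS, §1.2 (the scalar energy-transfer chain), §4 (4.8), §6.4; elementary (Gronwall)] -/
theorem le_exp_mul_of_le (hε : 0 < ε₀)
    (hV : ∀ (n : ℤ) (t : ℝ), t < 0 →
      HasDerivAt (V n) (bigLam ε₀ * V (n - 1) t ^ 2 - (bigLam ε₀)⁻¹ * (V n t * V (n + 1) t)) t)
    (hpos : ∀ (n : ℤ) (t : ℝ), t < 0 → 0 ≤ V n t)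
    {M : ℝ} (hact : ∀ n : ℤ, IntegrableOn (fun t => |V n t|) (Iio 0) ∧ ∫ t in Iio 0, |V n t| ≤ M)
    (n : ℤ) {t s : ℝ} (hts : t ≤ s) (hs : s < 0) :
    V n t ≤ Real.exp (M / bigLam ε₀) * V n s := by
  have hΛ : 0 < bigLam ε₀ := bigLam_pos (by linarith)
  have ht : t < 0 := lt_of_le_of_lt hts hs
  -- the integrating factor
  set I : ℝ → ℝ := fun u => ∫ τ in t..u, V (n + 1) τ with hI
  set h : ℝ → ℝ := fun u => V n u * Real.exp ((bigLam ε₀)⁻¹ * I u) with hh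
  have hIderiv : ∀ u, u < 0 → HasDerivAt I (V (n + 1) u) u := by
    intro u hu
    have hcont : ContinuousAt (V (n + 1)) u := (hV (n + 1) u hu).continuousAt
    refine intervalIntegral.integral_hasDerivAt_right (intervalIntegrable_shell hV (n + 1) ht hu) ?_ hcont
    exact ((continuousOn_shell hV (n + 1)).stronglyMeasurableAtFilter isOpen_Iio) u hu
  have hderiv : ∀ u, u < 0 → HasDerivAt h
      (Real.exp ((bigLam ε₀)⁻¹ * I u) * (bigLam ε₀ * V (n - 1) u ^ 2)) u := by
    intro u hu
    have h1 := hV n u hu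
    have h2 : HasDerivAt (fun w => Real.exp ((bigLam ε₀)⁻¹ * I w))
        (Real.exp ((bigLam ε₀)⁻¹ * I u) * ((bigLam ε₀)⁻¹ * V (n + 1) u)) u :=
      (((hIderiv u hu).const_mul (bigLam ε₀)⁻¹)).exp
    have h3 := h1.mul h2
    refine h3.congr_deriv ?_
    field_simp
    ring
  -- monotone on `[t, s]`
  have hmono : MonotoneOn h (Icc t s) := by
    refine monotoneOn_of_hasDerivWithinAt_nonneg (convex_Icc t s) ?_ ?_ ?_ (f' := fun u =>
      Real.exp ((bigLam ε₀)⁻¹ * I u) * (bigLam ε₀ * V (n - 1) u ^ 2))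
    · intro u hu
      exact (hderiv u (lt_of_le_of_lt hu.2 hs)).continuousAt.continuousWithinAt
    · intro u hu
      rw [interior_Icc] at hu
      exact (hderiv u (hu.2.trans hs)).hasDerivWithinAt
    · intro u _
      positivity
  have hts' := hmono (left_mem_Icc.2 hts) (right_mem_Icc.2 hts) hts
  -- evaluate
  have hIt : I t = 0 := by simp [hI]
  have hh_t : h t = V n t := by simp [hh, hIt]
  have hIs : I s ≤ M := integral_shell_le hpos hact (n + 1) hts hs
  have hexp : Real.exp ((bigLam ε₀)⁻¹ * I s) ≤ Real.exp (M / bigLam ε₀) := by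
    rw [Real.exp_le_exp, div_eq_inv_mul]
    exact mul_le_mul_of_nonneg_left hIs (inv_nonneg.2 hΛ.le)
  calc V n t = h t := hh_t.symm
    _ ≤ h s := hts'
    _ = V n s * Real.exp ((bigLam ε₀)⁻¹ * I s) := rfl
    _ ≤ V n s * Real.exp (M / bigLam ε₀) := mul_le_mul_of_nonneg_left hexp (hpos n s hs)
    _ = Real.exp (M / bigLam ε₀) * V n s := mul_comm _ _

/-- **NO OVERSHOOT.**  `V_n(t) ≤ e^{M/Λ} v_n` for every `t < 0`, where `v_n = lim_{s↑0} V_n(s)` is the terminal value: the terminal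
(wake) amplitude of a shell controls its entire history.
[cite: Tao2016AveragedNS, §1.2, §4 (4.8), §6.4; elementary] -/
theorem noOvershoot (hε : 0 < ε₀)
    (hV : ∀ (n : ℤ) (t : ℝ), t < 0 →
      HasDerivAt (V n) (bigLam ε₀ * V (n - 1) t ^ 2 - (bigLam ε₀)⁻¹ * (V n t * V (n + 1) t)) t)
    (hpos : ∀ (n : ℤ) (t : ℝ), t < 0 → 0 ≤ V n t)
    {M : ℝ} (hact : ∀ n : ℤ, IntegrableOn (fun t => |V n t|) (Iio 0) ∧ ∫ t in Iio 0, |V n t| ≤ M)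
    {v : ℤ → ℝ} (hv : ∀ n : ℤ, Tendsto (V n) (𝓝[<] 0) (𝓝 (v n)))
    (n : ℤ) {t : ℝ} (ht : t < 0) :
    V n t ≤ Real.exp (M / bigLam ε₀) * v n := by
  have hlim : Tendsto (fun s => Real.exp (M / bigLam ε₀) * V n s) (𝓝[<] 0)
      (𝓝 (Real.exp (M / bigLam ε₀) * v n)) := (hv n).const_mul _
  refine ge_of_tendsto hlim ?_
  have hmem : Ico t 0 ∈ 𝓝[<] (0 : ℝ) := Ico_mem_nhdsLT ht
  filter_upwards [hmem] with s hs
  exact le_exp_mul_of_le hε hV hpos hact n hs.1 hs.2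

/-- **A shell that is ever positive strands a positive wake**: `V_n(t) > 0` for some `t < 0` forces `v_n > 0`.
[cite: Tao2016AveragedNS, §1.2, §4 (4.8), §6.4; elementary] -/
theorem terminal_pos_of_pos (hε : 0 < ε₀)
    (hV : ∀ (n : ℤ) (t : ℝ), t < 0 →
      HasDerivAt (V n) (bigLam ε₀ * V (n - 1) t ^ 2 - (bigLam ε₀)⁻¹ * (V n t * V (n + 1) t)) t)
    (hpos : ∀ (n : ℤ) (t : ℝ), t < 0 → 0 ≤ V n t)
    {M : ℝ} (hact : ∀ n : ℤ, IntegrableOn (fun t => |V n t|) (Iio 0) ∧ ∫ t in Iio 0, |V n t| ≤ M)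
    {v : ℤ → ℝ} (hv : ∀ n : ℤ, Tendsto (V n) (𝓝[<] 0) (𝓝 (v n)))
    (n : ℤ) {t : ℝ} (ht : t < 0) (hVt : 0 < V n t) : 0 < v n := by
  have h := noOvershoot hε hV hpos hact hv n ht
  have hexp : 0 < Real.exp (M / bigLam ε₀) := Real.exp_pos _
  by_contra hle
  have hle' : v n ≤ 0 := not_lt.1 hle
  have : Real.exp (M / bigLam ε₀) * v n ≤ 0 := mul_nonpos_of_nonneg_of_nonpos hexp.le hle'
  linarith

/-- Terminal values are non-negative. [elementary] -/
theorem terminal_nonneg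
    (hpos : ∀ (n : ℤ) (t : ℝ), t < 0 → 0 ≤ V n t)
    {v : ℤ → ℝ} (hv : ∀ n : ℤ, Tendsto (V n) (𝓝[<] 0) (𝓝 (v n))) (n : ℤ) : 0 ≤ v n :=
  ge_of_tendsto (hv n) (eventually_nhdsWithin_of_forall fun t ht => hpos n t ht)

/-- **Bounded terminal growth, two-time form.**  For `t ≤ s < 0`:
`V_{n+1}(s) ≤ V_{n+1}(t) + Λ e^{M/Λ} v_n · M` — integrate `V̇_{n+1} ≤ Λ V_n² ≤ Λ e^{M/Λ} v_n · V_n` (no overshoot) against the action.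
[cite: Tao2016AveragedNS, §1.2, §4 (4.8), §6.4; elementary] -/
theorem succ_le_add (hε : 0 < ε₀)
    (hV : ∀ (n : ℤ) (t : ℝ), t < 0 →
      HasDerivAt (V n) (bigLam ε₀ * V (n - 1) t ^ 2 - (bigLam ε₀)⁻¹ * (V n t * V (n + 1) t)) t)
    (hpos : ∀ (n : ℤ) (t : ℝ), t < 0 → 0 ≤ V n t)
    {M : ℝ} (hact : ∀ n : ℤ, IntegrableOn (fun t => |V n t|) (Iio 0) ∧ ∫ t in Iio 0, |V n t| ≤ M)
    {v : ℤ → ℝ} (hv : ∀ n : ℤ, Tendsto (V n) (𝓝[<] 0) (𝓝 (v n)))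
    (n : ℤ) {t s : ℝ} (hts : t ≤ s) (hs : s < 0) :
    V (n + 1) s ≤ V (n + 1) t + bigLam ε₀ * Real.exp (M / bigLam ε₀) * v n * M := by
  have hΛ : 0 < bigLam ε₀ := bigLam_pos (by linarith)
  have ht : t < 0 := lt_of_le_of_lt hts hs
  set K : ℝ := bigLam ε₀ * Real.exp (M / bigLam ε₀) * v n with hK
  have hK0 : 0 ≤ K := by
    have := terminal_nonneg hpos hv n
    rw [hK]; positivity
  -- `g(u) = V_{n+1}(u) - K ∫_t^u V_n` is antitone on `[t, s]`
  set I : ℝ → ℝ := fun u => ∫ τ in t..u, V n τ with hI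
  set g : ℝ → ℝ := fun u => V (n + 1) u - K * I u with hg
  have hIderiv : ∀ u, u < 0 → HasDerivAt I (V n u) u := by
    intro u hu
    have hcont : ContinuousAt (V n) u := (hV n u hu).continuousAt
    refine intervalIntegral.integral_hasDerivAt_right (intervalIntegrable_shell hV n ht hu) ?_ hcont
    exact ((continuousOn_shell hV n).stronglyMeasurableAtFilter isOpen_Iio) u hu
  have hderiv : ∀ u, u < 0 → HasDerivAt g
      (bigLam ε₀ * V (n + 1 - 1) u ^ 2 - (bigLam ε₀)⁻¹ * (V (n + 1) u * V (n + 1 + 1) u) - K * V n u) u := by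
    intro u hu
    exact (hV (n + 1) u hu).sub ((hIderiv u hu).const_mul K)
  have hanti : AntitoneOn g (Icc t s) := by
    refine antitoneOn_of_hasDerivWithinAt_nonpos (convex_Icc t s) ?_ ?_ ?_ (f' := fun u =>
      bigLam ε₀ * V (n + 1 - 1) u ^ 2 - (bigLam ε₀)⁻¹ * (V (n + 1) u * V (n + 1 + 1) u) - K * V n u)
    · intro u hu
      exact (hderiv u (lt_of_le_of_lt hu.2 hs)).continuousAt.continuousWithinAt
    · intro u hu
      rw [interior_Icc] at hu
      exact (hderiv u (hu.2.trans hs)).hasDerivWithinAt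
    · intro u hu
      rw [interior_Icc] at hu
      have hu0 : u < 0 := hu.2.trans hs
      have h1 : V (n + 1 - 1) u = V n u := by rw [add_sub_cancel_right]
      rw [h1]
      have hVn := hpos n u hu0
      have hno : V n u ≤ Real.exp (M / bigLam ε₀) * v n := noOvershoot hε hV hpos hact hv n hu0
      have hdrain : 0 ≤ (bigLam ε₀)⁻¹ * (V (n + 1) u * V (n + 1 + 1) u) := by
        have := hpos (n + 1) u hu0
        have := hpos (n + 1 + 1) u hu0
        positivity
      have hfeed : bigLam ε₀ * V n u ^ 2 ≤ K * V n u := by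
        rw [hK, pow_two, ← mul_assoc]
        have : bigLam ε₀ * V n u ≤ bigLam ε₀ * Real.exp (M / bigLam ε₀) * v n := by
          rw [mul_assoc]; exact mul_le_mul_of_nonneg_left hno hΛ.le
        exact mul_le_mul_of_nonneg_right this hVn
      linarith
  have hts' := hanti (left_mem_Icc.2 hts) (right_mem_Icc.2 hts) hts
  have hIt : I t = 0 := by simp [hI]
  have hIs : I s ≤ M := integral_shell_le hpos hact n hts hs
  have hg_t : g t = V (n + 1) t := by simp [hg, hIt]
  have hg_s : g s = V (n + 1) s - K * I s := rfl
  have h1 : V (n + 1) s - K * I s ≤ V (n + 1) t := by rw [← hg_s, ← hg_t]; exact hts'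
  have h2 : K * I s ≤ K * M := mul_le_mul_of_nonneg_left hIs hK0
  linarith

/-- **BOUNDED TERMINAL GROWTH.**  If in addition `V_{n+1}(t) → 0` as `t → -∞` (automatic under the type-I bound `V ≤ C/(-t)`),
then `v_{n+1} ≤ Λ M e^{M/Λ} · v_n`: the terminal profile of a non-negative ancient admissible solution grows by at most a factor
fixed by the ACTION per shell.
[cite: Tao2016AveragedNS, §1.2, §4 (4.8), §6.4; elementary] -/
theorem terminal_succ_le (hε : 0 < ε₀)
    (hV : ∀ (n : ℤ) (t : ℝ), t < 0 →
      HasDerivAt (V n) (bigLam ε₀ * V (n - 1) t ^ 2 - (bigLam ε₀)⁻¹ * (V n t * V (n + 1) t)) t)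
    (hpos : ∀ (n : ℤ) (t : ℝ), t < 0 → 0 ≤ V n t)
    (hI : ∃ C : ℝ, ∀ (n : ℤ) (t : ℝ), t < 0 → V n t ≤ C / (-t))
    {M : ℝ} (hact : ∀ n : ℤ, IntegrableOn (fun t => |V n t|) (Iio 0) ∧ ∫ t in Iio 0, |V n t| ≤ M)
    {v : ℤ → ℝ} (hv : ∀ n : ℤ, Tendsto (V n) (𝓝[<] 0) (𝓝 (v n))) (n : ℤ) :
    v (n + 1) ≤ bigLam ε₀ * M * Real.exp (M / bigLam ε₀) * v n := by
  obtain ⟨C, hC⟩ := hI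
  set K : ℝ := bigLam ε₀ * Real.exp (M / bigLam ε₀) * v n * M with hK
  -- first: `V_{n+1}(s) ≤ K` for every `s < 0` (let `t → -∞`)
  have hbound : ∀ s : ℝ, s < 0 → V (n + 1) s ≤ K := by
    intro s hs
    refine le_of_forall_pos_lt_add fun δ hδ => ?_
    -- choose `t ≤ s` with `C/(-t) < δ`
    set t : ℝ := min s (-(|C| / δ + 1)) with ht
    have hts : t ≤ s := min_le_left _ _
    have ht2 : t ≤ -(|C| / δ + 1) := min_le_right _ _
    have htneg : 0 < -t := by
      have : 0 ≤ |C| / δ := by positivity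
      linarith
    have hCt : C / (-t) < δ := by
      rw [div_lt_iff₀ htneg]
      have h1 : |C| / δ + 1 ≤ -t := by linarith
      have h2 : |C| < δ * (|C| / δ + 1) := by
        rw [mul_add, mul_div_cancel₀ _ hδ.ne', mul_one]; linarith
      calc C ≤ |C| := le_abs_self C
        _ < δ * (|C| / δ + 1) := h2
        _ ≤ δ * (-t) := mul_le_mul_of_nonneg_left h1 hδ.le
    have h := succ_le_add hε hV hpos hact hv n hts hs
    have hVt : V (n + 1) t ≤ C / (-t) := hC (n + 1) t (by linarith)
    linarith
  have hlim := hv (n + 1)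
  have hle : v (n + 1) ≤ K := le_of_tendsto hlim (eventually_nhdsWithin_of_forall fun s hs => hbound s hs)
  calc v (n + 1) ≤ K := hle
    _ = bigLam ε₀ * M * Real.exp (M / bigLam ε₀) * v n := by rw [hK]; ring

/-- **Geometric growth of the terminal profile.**  `v_n ≤ (Λ M e^{M/Λ})ⁿ v_0` for `n ≥ 0`.
[cite: Tao2016AveragedNS, §1.2, §4 (4.8), §6.4; elementary] -/
theorem terminal_le_geometric (hε : 0 < ε₀)
    (hV : ∀ (n : ℤ) (t : ℝ), t < 0 →
      HasDerivAt (V n) (bigLam ε₀ * V (n - 1) t ^ 2 - (bigLam ε₀)⁻¹ * (V n t * V (n + 1) t)) t)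
    (hpos : ∀ (n : ℤ) (t : ℝ), t < 0 → 0 ≤ V n t)
    (hI : ∃ C : ℝ, ∀ (n : ℤ) (t : ℝ), t < 0 → V n t ≤ C / (-t))
    {M : ℝ} (hact : ∀ n : ℤ, IntegrableOn (fun t => |V n t|) (Iio 0) ∧ ∫ t in Iio 0, |V n t| ≤ M)
    {v : ℤ → ℝ} (hv : ∀ n : ℤ, Tendsto (V n) (𝓝[<] 0) (𝓝 (v n))) (n : ℕ) :
    v n ≤ (bigLam ε₀ * M * Real.exp (M / bigLam ε₀)) ^ n * v 0 := by
  have hΛ : 0 < bigLam ε₀ := bigLam_pos (by linarith)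
  have hM0 : 0 ≤ M := by
    obtain ⟨hint, hM⟩ := hact 0
    exact le_trans (setIntegral_nonneg measurableSet_Iio fun x _ => abs_nonneg _) hM
  have hρ : 0 ≤ bigLam ε₀ * M * Real.exp (M / bigLam ε₀) := by positivity
  induction n with
  | zero => simp
  | succ k ih =>
    have h1 := terminal_succ_le hε hV hpos hI hact hv (k : ℤ)
    have h2 : ((k : ℕ) : ℤ) + 1 = ((k + 1 : ℕ) : ℤ) := by push_cast; ring
    rw [h2] at h1
    calc v ((k + 1 : ℕ) : ℤ) ≤ bigLam ε₀ * M * Real.exp (M / bigLam ε₀) * v (k : ℤ) := h1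
      _ ≤ bigLam ε₀ * M * Real.exp (M / bigLam ε₀) *
            ((bigLam ε₀ * M * Real.exp (M / bigLam ε₀)) ^ k * v 0) := mul_le_mul_of_nonneg_left ih hρ
      _ = (bigLam ε₀ * M * Real.exp (M / bigLam ε₀)) ^ (k + 1) * v 0 := by ring

/-- **The small-action slice of (ρ0)|dyadic in classical form.**  If the per-shell growth ratio `Λ M e^{M/Λ}` set by the action is
below the (S₁) weight base `(1+ε₀)²` (`= Λ^{4/5}`), the a=1-weighted terminal wake tends to zero:
`physWeight(1)^n v_n² = (1+ε₀)^{-4n} v_n² → 0`.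
[cite: Tao2016AveragedNS, §1.2, §4 Thm. 4.2 (statement shape), §6.4; elementary] -/
theorem tendsto_weightedWake_of_smallAction (hε : 0 < ε₀)
    (hV : ∀ (n : ℤ) (t : ℝ), t < 0 →
      HasDerivAt (V n) (bigLam ε₀ * V (n - 1) t ^ 2 - (bigLam ε₀)⁻¹ * (V n t * V (n + 1) t)) t)
    (hpos : ∀ (n : ℤ) (t : ℝ), t < 0 → 0 ≤ V n t)
    (hI : ∃ C : ℝ, ∀ (n : ℤ) (t : ℝ), t < 0 → V n t ≤ C / (-t))
    {M : ℝ} (hact : ∀ n : ℤ, IntegrableOn (fun t => |V n t|) (Iio 0) ∧ ∫ t in Iio 0, |V n t| ≤ M)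
    (hsmall : bigLam ε₀ * M * Real.exp (M / bigLam ε₀) < (1 + ε₀) ^ 2)
    {v : ℤ → ℝ} (hv : ∀ n : ℤ, Tendsto (V n) (𝓝[<] 0) (𝓝 (v n))) :
    Tendsto (fun n : ℕ => physWeight 1 ε₀ ^ n * v n ^ 2) atTop (𝓝 0) := by
  have hb : (0 : ℝ) < 1 + ε₀ := by linarith
  have hΛ : 0 < bigLam ε₀ := bigLam_pos (by linarith)
  have hM0 : 0 ≤ M := by
    obtain ⟨hint, hM⟩ := hact 0
    exact le_trans (setIntegral_nonneg measurableSet_Iio fun x _ => abs_nonneg _) hM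
  set ρ : ℝ := bigLam ε₀ * M * Real.exp (M / bigLam ε₀) with hρ
  have hρ0 : 0 ≤ ρ := by rw [hρ]; positivity
  clear_value ρ
  have hw : physWeight 1 ε₀ = ((1 + ε₀) ^ 4)⁻¹ := by
    unfold physWeight
    rw [Real.rpow_one]
    field_simp
  -- the ratio `q = ρ² / (1+ε₀)^4 < 1`
  set q : ℝ := ((1 + ε₀) ^ 4)⁻¹ * ρ ^ 2 with hq
  have hq0 : 0 ≤ q := by rw [hq]; positivity
  have hq1 : q < 1 := by
    have h4 : (0 : ℝ) < (1 + ε₀) ^ 4 := by positivity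
    rw [hq, inv_mul_lt_iff₀ h4, mul_one]
    have : ρ ^ 2 < ((1 + ε₀) ^ 2) ^ 2 := pow_lt_pow_left₀ hsmall hρ0 two_ne_zero
    calc ρ ^ 2 < ((1 + ε₀) ^ 2) ^ 2 := this
      _ = (1 + ε₀) ^ 4 := by ring
  have hv0 : 0 ≤ v 0 := terminal_nonneg hpos hv 0
  have hbd : ∀ n : ℕ, physWeight 1 ε₀ ^ n * v n ^ 2 ≤ v 0 ^ 2 * q ^ n := by
    intro n
    have hvn0 : 0 ≤ v n := terminal_nonneg hpos hv n
    have hg := terminal_le_geometric hε hV hpos hI hact hv n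
    rw [← hρ] at hg
    have hsq : v n ^ 2 ≤ (ρ ^ n * v 0) ^ 2 := pow_le_pow_left₀ hvn0 hg 2
    have hw0 : 0 ≤ physWeight 1 ε₀ ^ n := by rw [hw]; positivity
    calc physWeight 1 ε₀ ^ n * v n ^ 2 ≤ physWeight 1 ε₀ ^ n * (ρ ^ n * v 0) ^ 2 :=
          mul_le_mul_of_nonneg_left hsq hw0
      _ = v 0 ^ 2 * q ^ n := by rw [hw, hq]; ring
  have hnn : ∀ n : ℕ, 0 ≤ physWeight 1 ε₀ ^ n * v n ^ 2 := fun n => by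
    have hw0 : 0 ≤ physWeight 1 ε₀ ^ n := by rw [hw]; positivity
    positivity
  have hgeom : Tendsto (fun n : ℕ => v 0 ^ 2 * q ^ n) atTop (𝓝 0) := by
    simpa using (tendsto_pow_atTop_nhds_zero_of_lt_one hq0 hq1).const_mul (v 0 ^ 2)
  exact squeeze_zero hnn hbd hgeom

end Summit.NavierStokesRegularity.NavierStokesRegularity.Theorems.NoSurvivingEternalViscBddOne.DyadicAncient

end
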